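import Summits.ResolutionOfSingularities.ResolutionOfSingularities.Theorems.PurelyInseparableDim4WildConesRun
import HarnessLib
import HarnessLib.Audit.Tags

/-!
# Infinite point-blow-up chains leave the isolated / Milnor-finite regime INFINITELY OFTEN
# (bridge WildCones ↔ `PIDim4`, appendix; cell `res-dim4-pi`)

[OURS · counted 0 · shift-closure readings of the bridge theorems (crit-5 K-A5-01's «infinitely often»
form of F4-I); nothing here is a statement about resolution of singularities.]

* `infinitely_many_not_milnorFinite` — every prime `p`, perfect `K`: along every infinite `Step0 p`
  chain, for every `N` some state of index `≥ N` has an INFINITE formal Milnor algebra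
  (`noMilnorFiniteStep0Chain` applied to the shifted chain).
* `infinitely_many_not_isIsolated_two` — `p = 2`, every field: along every infinite `Step0 2` chain,
  for every `N` some state of index `≥ N` is NOT an isolated `2`-fold point
  (`noIsolatedTrap_two_two` applied to the shifted chain).

bears_on: LADDER-RESOLUTION:D157-DOOR2 (res-dim4-pi · F4-I). Supports
stmt-ResolutionOfSingularities-16155 (helper).
-/

set_option linter.dupNamespace false

noncomputable section

namespace Summit.ResolutionOfSingularities.ResolutionOfSingularities.Theorems.PIDim4

namespace WildConesBridge

open MvPolynomial
open Literature.AlgebraicGeometry.Resolution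

/-- **Every infinite `Step0 p` chain over a perfect field has Milnor-INFINITE states beyond every
index.** [OURS · counted 0] [folklore] -/
theorem infinitely_many_not_milnorFinite (p : ℕ) (hp : p.Prime) (K : Type) [Field K] [CharP K p]
    [PerfectField K] [DecidableEq K] (c : ℕ → State K) (hc : ∀ k, Step0 p (c k) (c (k + 1))) (N : ℕ) :
    ∃ k, N ≤ k ∧ ¬ Module.Finite K (MvPowerSeries (Fin 4) K ⧸ Ideal.span (Set.range fun t : Fin 4 =>
      MvPowerSeries.pderiv t (((c k).F : MvPolynomial (Fin 4) K) : MvPowerSeries (Fin 4) K))) := by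
  by_contra h
  push Not at h
  refine noMilnorFiniteStep0Chain p hp K ⟨fun k => c (N + k), fun k => ⟨?_, ?_⟩⟩
  · show Step0 p (c (N + k)) (c (N + (k + 1)))
    exact hc (N + k)
  · show Module.Finite K (MvPowerSeries (Fin 4) K ⧸ Ideal.span (Set.range fun t : Fin 4 =>
      MvPowerSeries.pderiv t (((c (N + (k + 1))).F : MvPolynomial (Fin 4) K) : MvPowerSeries (Fin 4) K)))
    exact h (N + (k + 1)) (Nat.le_add_right N (k + 1))

/-- **At `p = 2`, over EVERY field: every infinite `Step0 2` chain has NON-ISOLATED states beyond every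
index** — the «infinitely often» reading of F4-I(2,2). [OURS · counted 0] [folklore] -/
theorem infinitely_many_not_isIsolated_two (K : Type) [Field K] [CharP K 2] [DecidableEq K]
    (c : ℕ → State K) (hc : ∀ k, Step0 2 (c k) (c (k + 1))) (N : ℕ) :
    ∃ k, N ≤ k ∧ ¬ IsIsolated 2 (c k).F := by
  by_contra h
  push Not at h
  refine noIsolatedTrap_two_two K ⟨fun k => c (N + k), fun k => ⟨h (N + k) (Nat.le_add_right N k), ?_⟩⟩
  show Step0 2 (c (N + k)) (c (N + (k + 1)))
  exact hc (N + k)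

/-- Equivalently: an infinite `Step0 2` chain whose states are isolated from some index on does not
exist (every field of characteristic `2`). [OURS · counted 0] [folklore] -/
theorem no_eventually_isolated_chain_two (K : Type) [Field K] [CharP K 2] [DecidableEq K]
    (c : ℕ → State K) (hc : ∀ k, Step0 2 (c k) (c (k + 1))) (N : ℕ) :
    ¬ ∀ k, N ≤ k → IsIsolated 2 (c k).F := by
  intro h
  obtain ⟨k, hk, hnot⟩ := infinitely_many_not_isIsolated_two K c hc N
  exact hnot (h k hk)

end WildConesBridge

end Summit.ResolutionOfSingularities.ResolutionOfSingularities.Theorems.PIDim4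

end
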